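import Summits.ResolutionOfSingularities.ResolutionOfSingularities.Theorems.PurelyInseparableDim4PhiLineLabelPropagation
import Summits.ResolutionOfSingularities.ResolutionOfSingularities.Theorems.PurelyInseparableDim4PhiLineConeBridge
import HarnessLib

/-!
# (K-Φ2) chain dictionary XIII: LABEL ⇒ VERTEX — in a label frame the `y`-rows annihilate the residual vertex

Cell `res-dim4-pi` (D-0157 DOOR 2), Φ = β_h line (CARD I-1-8; B∞ assembly skeleton of res-dim4-p-12, conjunct 3 of `EntryInv`/`RunInv`, asked
by res-dim4-p-2 g5 (STUB L) and res-dim4-p-7 g4 (STUB K)). If the carried linear frame `A` is a LABEL for the residual `G` (`d! < δs`, i.e.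
`G/1 ∈ (y)^d + 𝔪^{d+1}`) and the state is a binary cone (`e_G = finrank (resVertex s) = 2`), then the two `y`-rows of `A` vanish on the vertex
`resVertex s = A(in_d G)`: **`yRows_annihilate_of_label`**. Route (DEF-FREE): `δ > 1` in frame coordinates ((K-Φ2) VIII) ⇒ `σ_B G ∈
F^{(d!+1, d!+1, d!, d!)}_{(d!+1)d}` ((K-Φ3) IV) ⇒ contracted to `K[x]` ((K-Φ2) VI) the degree-`d` monomials of `σ_B G` are `u`-free ⇒
`A(in_d σ_B G) ⊇ {v : v_y = 0}`, equality by `e_G = 2` ((K-Φ2) VIII/IX/XI) ⇒ for `w ∈ resVertex s`, `A·w ∈ A(in_d σ_B G)` (`𝕎(σ_B S) = B⁻¹𝕎(S)`,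
tame degree `d < p`) has zero `y`-coordinates.

[OURS · counted 0 · AI work weaker than expert review.] Nothing here proves K2(p), the β_h line, or resolution of singularities in dimension ≥ 4 /
characteristic p.

Sources: V. Cossart, U. Jannsen, S. Saito (2020) Def. 1.26, Def. 8.4, Lemma 12.2 [`CossartJannsenSaito2020`]; V. Cossart, O. Piltant, J. Algebra 320
(2008) proof of Prop. 4.2 [`CossartPiltant2008`].
-/

set_option linter.dupNamespace false

noncomputable section

namespace Summit.ResolutionOfSingularities.ResolutionOfSingularities.Theorems.PIDim4

namespace PhiLine

open MvPolynomial Finset IsLocalRing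
open Literature.AlgebraicGeometry.Resolution
open Literature.AlgebraicGeometry.Resolution.Hauser2010
open Literature.AlgebraicGeometry.Resolution.WeightedOrder
open Literature.AlgebraicGeometry.Resolution.PointBlowup (additiveSubspace)

variable {K : Type} [Field K]

/-- **In a label frame (coordinate frame) the initial form is `u`-free**: if `d! < δs(c₀, P/1)` then every degree-`d` monomial of `P` has
`m(u₁) = m(u₂) = 0`. [cite: CossartJannsenSaito2020, Def. 8.4] -/
theorem apply_u_eq_zero_of_factorial_lt_deltaS {P : MvPolynomial (Fin 4) K} {d : ℕ}
    (hδ : d.factorial < deltaS (fun i : Fin (2 + 2) => algebraMap (MvPolynomial (Fin 4) K) (OriginLocalization K 4) (X i))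
      (Ideal.span {algebraMap (MvPolynomial (Fin 4) K) (OriginLocalization K 4) P}) d)
    {m : Fin (2 + 2) →₀ ℕ} (hm : m ∈ (homogeneousComponent d P).support) : m (u1 2) = 0 ∧ m (u2 2) = 0 := by
  classical
  set c₀ : Fin (2 + 2) → OriginLocalization K 4 := fun i => algebraMap (MvPolynomial (Fin 4) K) (OriginLocalization K 4) (X i) with hc₀
  have hgen : Ideal.span (Set.range c₀) = maximalIdeal (OriginLocalization K 4) := span_range_coordFrame_eq_maximalIdeal
  have hJ := le_yIdeal_pow_sup_of_factorial_lt_deltaS c₀ d hgen ringKrullDim_originLocalization_two_add_two hδ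
  rw [← weightedOrderIdeal_levelWeight_succ_eq c₀ d hgen] at hJ
  have hPmem := hJ (Ideal.mem_span_singleton_self _)
  rw [mem_support_iff, coeff_homogeneousComponent] at hm
  split_ifs at hm with hdeg
  · have hall := mem_weightedOrderIdeal_X_of_algebraMap_mem (levelWeight_pos (by omega : 0 < d.factorial + 1) Nat.one_pos Nat.one_pos)
      hPmem m (mem_support_iff.mpr hm)
    rw [WeightedOrder.weight_levelWeight, one_mul, one_mul] at hall
    have hy : ydeg m = m 0 + m 1 := by rw [ydeg, Fin.sum_univ_two]; rfl
    rw [Finsupp.degree_eq_sum, Fin.sum_univ_four] at hdeg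
    change m 0 + m 1 + m (u1 2) + m (u2 2) = d at hdeg
    have hd' : d = ydeg m + (m (u1 2) + m (u2 2)) := by rw [hy, ← hdeg, add_assoc]
    have h2 : (d.factorial + 1) * (ydeg m + (m (u1 2) + m (u2 2))) ≤ (d.factorial + 1) * ydeg m + d.factorial * (m (u1 2) + m (u2 2)) := by
      rw [← hd']; exact hall
    rw [mul_add, add_one_mul (d.factorial) (m (u1 2) + m (u2 2))] at h2
    -- `h2 : (d!+1)·y + (d!·u + u) ≤ (d!+1)·y + d!·u`
    have h1 : d.factorial * (m (u1 2) + m (u2 2)) + (m (u1 2) + m (u2 2)) ≤ d.factorial * (m (u1 2) + m (u2 2)) + 0 :=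
      Nat.le_of_add_le_add_left h2
    have h0 : m (u1 2) + m (u2 2) = 0 := Nat.le_zero.mp (Nat.le_of_add_le_add_left h1)
    omega
  · exact (hm rfl).elim

/-- The partial derivative along a letter that no monomial carries vanishes. [folklore] -/
theorem pderiv_eq_zero_of_forall_apply_eq_zero {Φ : MvPolynomial (Fin 4) K} {u : Fin 4} (hfree : ∀ m ∈ Φ.support, m u = 0) :
    pderiv u Φ = 0 := by
  classical
  ext m
  rw [coeff_pderiv, coeff_zero]
  by_cases hc : coeff (m + Finsupp.single u 1) Φ = 0
  · rw [hc, zero_mul]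
  · have h := hfree _ (mem_support_iff.mpr hc)
    rw [Finsupp.add_apply, Finsupp.single_eq_same] at h
    omega

/-- **LABEL ⇒ VERTEX.** For a presented state `s.F = x^{s.r}·G`, `ord₀ G = d < p`, a carried invertible linear frame `A` (`A B = 1 = B A`) in
which `G` is a label (`d! < δs`), and `e_G = 2`: every `y`-row of `A` (index `∉ {u₁, u₂}`) annihilates `resVertex s`.
[cite: CossartJannsenSaito2020, Def. 1.26, Def. 8.4, Lemma 12.2] [cite: CossartPiltant2008, proof of Prop. 4.2] -/
theorem yRows_annihilate_of_label (p : ℕ) [CharP K p] {d : ℕ} (hdp : d < p) {s : State K} {G : MvPolynomial (Fin 4) K}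
    (hF : s.F = monomial s.r 1 * G) (hd : ordZero G = d) {A B : Matrix (Fin 4) (Fin 4) K} (hAB : A * B = 1) (hBA : B * A = 1)
    (he : Module.finrank K (ResCone.resVertex s) = 2)
    (hδ : d.factorial < deltaS (fun i : Fin (2 + 2) => algebraMap (MvPolynomial (Fin 4) K) (OriginLocalization K 4) (∑ t, C (A i t) * X t))
      (Ideal.span {algebraMap (MvPolynomial (Fin 4) K) (OriginLocalization K 4) G}) d) :
    ∀ i : Fin (2 + 2), i ≠ u1 2 → i ≠ u2 2 → ∀ w ∈ ResCone.resVertex s, ∑ t, A i t * w t = 0 := by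
  classical
  set P := linSubst K B G with hP
  set Φ := homogeneousComponent d P with hΦ
  -- (1) `δ > 1` in frame coordinates ⇒ `Φ` is `u`-free
  have hδ₀ : d.factorial < deltaS (fun i : Fin (2 + 2) => algebraMap (MvPolynomial (Fin 4) K) (OriginLocalization K 4) (X i))
      (Ideal.span {algebraMap (MvPolynomial (Fin 4) K) (OriginLocalization K 4) P}) d := by
    rw [hP, ← deltaS_linearFrame_eq_deltaS_coordFrame hAB hBA]; exact hδ
  have hfree : ∀ m ∈ Φ.support, m (u1 2) = 0 ∧ m (u2 2) = 0 := fun m hm => apply_u_eq_zero_of_factorial_lt_deltaS hδ₀ hm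
  -- (2) `{v : v_y = 0} ≤ A(Φ)`
  set π : (Fin (2 + 2) → K) →ₗ[K] (Fin 2 → K) := LinearMap.funLeft K K (Fin.castAdd 2 : Fin 2 → Fin (2 + 2)) with hπ
  have hu1 : pderiv (u1 2) Φ = 0 := pderiv_eq_zero_of_forall_apply_eq_zero fun m hm => (hfree m hm).1
  have hu2 : pderiv (u2 2) Φ = 0 := pderiv_eq_zero_of_forall_apply_eq_zero fun m hm => (hfree m hm).2
  have hV : LinearMap.ker π ≤ additiveSubspace Φ := by
    intro v hv
    rw [LinearMap.mem_ker] at hv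
    have hvy : ∀ k : Fin 2, v (Fin.castAdd 2 k) = 0 := fun k => by
      have h := congrFun hv k
      rwa [hπ, LinearMap.funLeft_apply] at h
    show v ∈ additiveSubspace Φ
    rw [mem_additiveSubspace_iff_sum_smul_pderiv, Fin.sum_univ_four]
    change v (Fin.castAdd 2 0) • pderiv (Fin.castAdd 2 0) Φ + v (Fin.castAdd 2 1) • pderiv (Fin.castAdd 2 1) Φ +
      v (u1 2) • pderiv (u1 2) Φ + v (u2 2) • pderiv (u2 2) Φ = 0
    rw [hvy 0, hvy 1, hu1, hu2, zero_smul, zero_smul, smul_zero, smul_zero, add_zero, add_zero, add_zero]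
  -- (3) dimensions: `dim A(Φ) = e_G = 2 = dim ker π`
  have hΦG : Φ = linSubst K B (homogeneousComponent d G) := by rw [hΦ, hP, homogeneousComponent_linSubst]
  have hfin : Module.finrank K (additiveSubspace Φ) = 2 := by
    rw [hΦG, finrank_additiveSubspace_linSubst p hBA hAB (homogeneousComponent_isHomogeneous d G) hdp,
      ← resVertex_eq_additiveSubspace hF hd, he]
  have hker : Module.finrank K (LinearMap.ker π) = 2 := by
    have h1 := LinearMap.finrank_range_add_finrank_ker π
    rw [LinearMap.range_eq_top.mpr (LinearMap.funLeft_surjective_of_injective K K _ (Fin.castAdd_injective 2 2)), finrank_top,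
      Module.finrank_fin_fun K, Module.finrank_fin_fun K] at h1
    omega
  have hEq : LinearMap.ker π = additiveSubspace Φ := Submodule.eq_of_le_of_finrank_eq hV (by rw [hker, hfin])
  -- (4) transport `w ↦ A·w`
  intro i hi1 hi2 w hw
  obtain ⟨k, rfl⟩ : ∃ k : Fin 2, i = Fin.castAdd 2 k := by
    induction i using Fin.addCases with
    | left k => exact ⟨k, rfl⟩
    | right j =>
      exfalso
      fin_cases j
      · exact hi1 rfl
      · exact hi2 rfl
  have hwA : w ∈ additiveSubspace (homogeneousComponent d G) := by rw [← resVertex_eq_additiveSubspace hF hd]; exact hw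
  have h1 : (homogeneousComponent d G).totalDegree < p := lt_of_le_of_lt (homogeneousComponent_isHomogeneous d G).totalDegree_le hdp
  have h2 : (linSubst K B (homogeneousComponent d G)).totalDegree < p :=
    lt_of_le_of_lt (isHomogeneous_linSubst B (homogeneousComponent_isHomogeneous d G)).totalDegree_le hdp
  have hAw : A.mulVec w ∈ additiveSubspace Φ := by
    rw [hΦG, additiveSubspace_eq_invarianceSpace p h2, ← Set.image_singleton, mem_invarianceSpace_image_linSubst_iff K hBA,
      Matrix.mulVec_mulVec, hBA, Matrix.one_mulVec, ← additiveSubspace_eq_invarianceSpace p h1]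
    exact hwA
  rw [← hEq, LinearMap.mem_ker] at hAw
  have h := congrFun hAw k
  rw [hπ, LinearMap.funLeft_apply, Pi.zero_apply] at h
  exact h

end PhiLine

end Summit.ResolutionOfSingularities.ResolutionOfSingularities.Theorems.PIDim4

end
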